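import Mathlib
import HarnessLib
import Summits.Ventures.LatticeQCDFlow.Exactness.NCMCGeneralSpaceBennettBlocksRootVariance
import Summits.Ventures.LatticeQCDFlow.Exactness.NCMCGeneralSpaceBennettRootBounds

/-!
# Bounds on Bennett's variance constant `1/G_{a,b} − 1/a − 1/b` (unequal sample sizes): the switch acceptance at the shifted constant brackets it, both one-sided Jarzynski variances dominate it

HONEST FRAMING: exact (Metropolis-corrected) sampling algorithms for lattice gauge theory;
figures of merit are autocorrelation/cost numbers at stated couplings and volumes; no
continuum-physics claim.

Venture `LatticeQCDFlow` (cell pub-lqcd), topic `Exactness`; FANOUT row 13 (`eng-snf`, GEN-15).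
NEW WORK of the cell (bookkeeping on GEN-11's `bennett_lower_bound` and `NCMCGeneralSpaceBennettRoot`),
not a published result; nothing is cited as a fact (Bennett 1976 named only).  The `a : b` version of
`NCMCGeneralSpaceBennettRootBounds.lean` (GEN-15 (42)); companion of `…BennettBlocksRoot.lean`
((46b): with `nf = a n`, `nr = b n` independent evolutions `√n (ΔF̂_n − ΔF) →d N(0, 1/G_{a,b} − 1/a − 1/b)`).

## Content (a Crooks pair, `e^{−ΔF} = Z₁/Z₀`; reals `a, b > 0`; `c⋆` with `a e^{c⋆−ΔF} = b`, i.e.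
`c⋆ = ΔF − log(a/b)`; `g = E_F σ(c⋆ − W)`, `G_{a,b} = E_R[(e^{ΔF−W}/a + 1/b)⁻¹] = a g`;
`acc(c⋆) = E_F min(1, e^{−(W − c⋆)})` the Metropolized switch acceptance at pseudo-prior constant `c⋆`)

* **`CrooksPair.blocksBound_le_of_accept`** / **`CrooksPair.le_blocksBound_of_accept`** —
  `1/(a·acc(c⋆)) − 1/a − 1/b ≤ 1/G_{a,b} − 1/a − 1/b ≤ 2/(a·acc(c⋆)) − 1/a − 1/b`
  (`acc/2 ≤ g ≤ acc` at every constant, GEN-11).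
* **`CrooksPair.blocksBound_le_inv_essF`** — `1/G_{a,b} − 1/a − 1/b ≤ (1/ESS_F − 1)/a`
  (`bennett_lower_bound` at `(a, b)` with the constant statistic): with `nf = a n` forward evolutions
  the self-consistent Bennett estimate is, to leading order, never worse than the forward Jarzynski
  average of the same works (variance `(1/ESS_F − 1)/nf`) — whatever `nr ≥ 1`; `e^{−W} ∈ L²(P_F)`.
* `CrooksPair.bennettG_le_harmonic` — `G_{a,b} ≤ ab/(a+b)`: the variance constant is non-negative.
* `CrooksPair.bennettG_symm` — `E_R[(e^{ΔF−W}/a + 1/b)⁻¹] = E_F[(e^{−(ΔF−W)}/b + 1/a)⁻¹]` (the pair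
  read backwards has the same `G` with `a ↔ b`); **`CrooksPair.blocksBound_le_inv_essR`** —
  `1/G_{a,b} − 1/a − 1/b ≤ (1/ESS_R − 1)/b` (`e^{W} ∈ L²(P_R)`).

Scope: population constants; no cost accounting.
-/

namespace Summit.Ventures.LatticeQCDFlow.Exactness.GeneralNCMC

open MeasureTheory ProbabilityTheory Set Filter
open scoped ENNReal

variable {Ω E : Type*} [MeasurableSpace Ω] [MeasurableSpace E]

namespace CrooksPair

variable {ν₀ ν₁ : Measure Ω} {κF κR : Kernel Ω E} {s e : E → Ω} {W : E → ℝ}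

/-! ## The switch acceptance at the shifted constant brackets the bound -/

/-- **`1/G_{a,b} − 1/a − 1/b ≤ 2/(a·acc(c⋆)) − 1/a − 1/b`** (`acc(c⋆)/2 ≤ g`). -/
theorem blocksBound_le_of_accept [IsFiniteMeasure ν₀] [IsFiniteMeasure ν₁] [IsMarkovKernel κF]
    [IsMarkovKernel κR] (h0 : ν₀ univ ≠ 0) (h1 : ν₁ univ ≠ 0) (h : CrooksPair ν₀ ν₁ κF κR s e W)
    {ΔF : ℝ} (hΔF : Real.exp (-ΔF) = ((ν₀ univ)⁻¹ * ν₁ univ).toReal) {a b c : ℝ} (ha : 0 < a)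
    (hc : a * Real.exp (c - ΔF) = b) :
    1 / (∫ ε, (Real.exp (ΔF - W ε) / a + 1 / b)⁻¹ ∂(fwdPathLaw ν₁ κR)) - 1 / a - 1 / b ≤
      2 / (a * ∫ ε, min 1 (Real.exp (-(W ε - c))) ∂(fwdPathLaw ν₀ κF)) - 1 / a - 1 / b := by
  rw [h.inv_mul_overlap_eq_bennett_bound h0 h1 hΔF ha hc]
  have hG := h.overlap_pos h0 c
  have hhalf := h.half_accept_le_integral_sigmoid h0 c
  have hacc : 0 < ∫ ε, min 1 (Real.exp (-(W ε - c))) ∂(fwdPathLaw ν₀ κF) := by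
    have := h.integral_sigmoid_le_accept h0 c
    linarith
  have hkey : 1 / (a * ∫ ε, Real.sigmoid (c - W ε) ∂(fwdPathLaw ν₀ κF)) ≤
      2 / (a * ∫ ε, min 1 (Real.exp (-(W ε - c))) ∂(fwdPathLaw ν₀ κF)) := by
    rw [div_le_div_iff₀ (mul_pos ha hG) (mul_pos ha hacc)]
    nlinarith
  linarith

/-- **`1/(a·acc(c⋆)) − 1/a − 1/b ≤ 1/G_{a,b} − 1/a − 1/b`** (`g ≤ acc(c⋆)`). -/
theorem le_blocksBound_of_accept [IsFiniteMeasure ν₀] [IsFiniteMeasure ν₁] [IsMarkovKernel κF]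
    [IsMarkovKernel κR] (h0 : ν₀ univ ≠ 0) (h1 : ν₁ univ ≠ 0) (h : CrooksPair ν₀ ν₁ κF κR s e W)
    {ΔF : ℝ} (hΔF : Real.exp (-ΔF) = ((ν₀ univ)⁻¹ * ν₁ univ).toReal) {a b c : ℝ} (ha : 0 < a)
    (hc : a * Real.exp (c - ΔF) = b) :
    1 / (a * ∫ ε, min 1 (Real.exp (-(W ε - c))) ∂(fwdPathLaw ν₀ κF)) - 1 / a - 1 / b ≤
      1 / (∫ ε, (Real.exp (ΔF - W ε) / a + 1 / b)⁻¹ ∂(fwdPathLaw ν₁ κR)) - 1 / a - 1 / b := by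
  rw [h.inv_mul_overlap_eq_bennett_bound h0 h1 hΔF ha hc]
  have hG := h.overlap_pos h0 c
  have hle := h.integral_sigmoid_le_accept h0 c
  have hkey : 1 / (a * ∫ ε, min 1 (Real.exp (-(W ε - c))) ∂(fwdPathLaw ν₀ κF)) ≤
      1 / (a * ∫ ε, Real.sigmoid (c - W ε) ∂(fwdPathLaw ν₀ κF)) :=
    one_div_le_one_div_of_le (mul_pos ha hG) (mul_le_mul_of_nonneg_left hle ha.le)
  linarith

/-- **Bennett's `G_{a,b}` is at most the harmonic bound `ab/(a+b)`** — equivalently the variance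
constant `1/G_{a,b} − 1/a − 1/b` is non-negative (it is a variance over a squared sensitivity:
`blocksNoise_eq`, `a g (1 − g(a+b)/b) ≥ 0`). -/
theorem bennettG_le_harmonic [IsFiniteMeasure ν₀] [IsFiniteMeasure ν₁] [IsMarkovKernel κF]
    [IsMarkovKernel κR] (h0 : ν₀ univ ≠ 0) (h1 : ν₁ univ ≠ 0) (h : CrooksPair ν₀ ν₁ κF κR s e W)
    {ΔF : ℝ} (hΔF : Real.exp (-ΔF) = ((ν₀ univ)⁻¹ * ν₁ univ).toReal) {a b c : ℝ} (ha : 0 < a)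
    (hc : a * Real.exp (c - ΔF) = b) :
    ∫ ε, (Real.exp (ΔF - W ε) / a + 1 / b)⁻¹ ∂(fwdPathLaw ν₁ κR) ≤ a * b / (a + b) := by
  have hb : 0 < b := by rw [← hc]; positivity
  rw [h.inv_mul_overlap_eq_bennett_bound h0 h1 hΔF ha hc]
  set g := ∫ ε, Real.sigmoid (c - W ε) ∂(fwdPathLaw ν₀ κF) with hg
  have hgpos : 0 < g := h.overlap_pos h0 c
  have hnn : 0 ≤ a * Var[fun ε => Real.sigmoid (c - W ε); fwdPathLaw ν₀ κF] +
      b * Var[fun ε => Real.sigmoid (W ε - c); fwdPathLaw ν₁ κR] :=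
    add_nonneg (mul_nonneg ha.le (variance_nonneg _ _)) (mul_nonneg hb.le (variance_nonneg _ _))
  rw [h.blocksNoise_eq h0 h1 hΔF ha hc] at hnn
  have h1' : 0 ≤ 1 - g * (a + b) / b := nonneg_of_mul_nonneg_right hnn (mul_pos ha hgpos)
  have h2 : g * (a + b) ≤ b := by
    have := mul_le_mul_of_nonneg_right (sub_nonneg.1 h1') hb.le
    rwa [div_mul_cancel₀ _ hb.ne', one_mul] at this
  rw [le_div_iff₀ (by positivity : (0 : ℝ) < a + b)]
  nlinarith

/-! ## Both one-sided Jarzynski variances dominate the bound -/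

/-- **`1/G_{a,b} − 1/a − 1/b ≤ (1/ESS_F − 1)/a`** (`bennett_lower_bound` at `nf = a`, `nr = b` with
`α ≡ 1`; `e^{−W} ∈ L²(P_F)`). -/
theorem blocksBound_le_inv_essF [IsFiniteMeasure ν₀] [IsFiniteMeasure ν₁] [IsMarkovKernel κF]
    [IsMarkovKernel κR] (h0 : ν₀ univ ≠ 0) (h1 : ν₁ univ ≠ 0) (h : CrooksPair ν₀ ν₁ κF κR s e W)
    {ΔF : ℝ} (hΔF : Real.exp (-ΔF) = ((ν₀ univ)⁻¹ * ν₁ univ).toReal) {a b : ℝ} (ha : 0 < a)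
    (hb : 0 < b) (hL2 : MemLp (fun ε => Real.exp (-W ε)) 2 (fwdPathLaw ν₀ κF)) :
    1 / (∫ ε, (Real.exp (ΔF - W ε) / a + 1 / b)⁻¹ ∂(fwdPathLaw ν₁ κR)) - 1 / a - 1 / b ≤
      ((∫ ε, Real.exp (-(2 * W ε)) ∂(fwdPathLaw ν₀ κF)) /
          (∫ ε, Real.exp (-W ε) ∂(fwdPathLaw ν₀ κF)) ^ 2 - 1) / a := by
  haveI := isProbabilityMeasure_fwdPathLaw ν₀ h0 κF
  haveI := isProbabilityMeasure_fwdPathLaw ν₁ h1 κR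
  have hα2w : Integrable (fun ε => Real.exp (ΔF - W ε) * (fun _ : E => (1 : ℝ)) ε ^ 2)
      (fwdPathLaw ν₁ κR) := by
    have hsq : Integrable (fun ε => Real.exp (ΔF - W ε) * Real.exp (ΔF - W ε)) (fwdPathLaw ν₀ κF) := by
      refine (hL2.integrable_sq.const_mul (Real.exp ΔF * Real.exp ΔF)).congr
        (Eventually.of_forall fun ε => ?_)
      beta_reduce
      rw [sq, sub_eq_add_neg, Real.exp_add]
      ring
    have := (h.integrable_density_mul_iff h0 h1 hΔF (fun ε => Real.exp (ΔF - W ε))).1 hsq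
    refine this.congr (Eventually.of_forall fun ε => ?_)
    simp only [one_pow, mul_one]
  have hb' := h.bennett_lower_bound h0 h1 hΔF ha hb (α := fun _ => (1 : ℝ)) measurable_const
    (by rw [integral_const, smul_eq_mul, mul_one, probReal_univ]; exact one_ne_zero)
    (by simp) hα2w
  refine hb'.trans (le_of_eq ?_)
  have hsqf : ∫ ε, ((1 : ℝ) * Real.exp (-W ε)) ^ 2 ∂(fwdPathLaw ν₀ κF) =
      ∫ ε, Real.exp (-(2 * W ε)) ∂(fwdPathLaw ν₀ κF) := by
    refine integral_congr_ae (Eventually.of_forall fun ε => ?_)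
    simp only
    rw [one_mul, sq, ← Real.exp_add]
    congr 1
    ring
  simp only [one_mul] at hsqf ⊢
  rw [hsqf, one_pow, integral_const, smul_eq_mul, mul_one, probReal_univ]
  ring

/-- **Bennett's `G` is symmetric under reading the pair backwards**:
`E_R[(e^{ΔF−W}/a + 1/b)⁻¹] = E_F[(e^{−(ΔF−W)}/b + 1/a)⁻¹]` (change of measure `dP_R = e^{ΔF−W} dP_F`). -/
theorem bennettG_symm [IsFiniteMeasure ν₀] [IsFiniteMeasure ν₁] [IsMarkovKernel κF]
    [IsMarkovKernel κR] (h0 : ν₀ univ ≠ 0) (h1 : ν₁ univ ≠ 0) (h : CrooksPair ν₀ ν₁ κF κR s e W)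
    {ΔF : ℝ} (hΔF : Real.exp (-ΔF) = ((ν₀ univ)⁻¹ * ν₁ univ).toReal) {a b : ℝ} (ha : 0 < a)
    (hb : 0 < b) :
    ∫ ε, (Real.exp (ΔF - W ε) / a + 1 / b)⁻¹ ∂(fwdPathLaw ν₁ κR) =
      ∫ ε, (Real.exp (-(ΔF - W ε)) / b + 1 / a)⁻¹ ∂(fwdPathLaw ν₀ κF) := by
  rw [← h.integral_density_mul h0 h1 hΔF]
  refine integral_congr_ae (Eventually.of_forall fun ε => ?_)
  simp only
  have hpos : 0 < Real.exp (ΔF - W ε) := Real.exp_pos _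
  rw [Real.exp_neg]
  field_simp
  ring

/-- **`1/G_{a,b} − 1/a − 1/b ≤ (1/ESS_R − 1)/b`** (the pair read backwards; `e^{W} ∈ L²(P_R)`). -/
theorem blocksBound_le_inv_essR [IsFiniteMeasure ν₀] [IsFiniteMeasure ν₁] [IsMarkovKernel κF]
    [IsMarkovKernel κR] (h0 : ν₀ univ ≠ 0) (h1 : ν₁ univ ≠ 0) (h : CrooksPair ν₀ ν₁ κF κR s e W)
    {ΔF : ℝ} (hΔF : Real.exp (-ΔF) = ((ν₀ univ)⁻¹ * ν₁ univ).toReal) {a b : ℝ} (ha : 0 < a)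
    (hb : 0 < b) (hL2 : MemLp (fun ε => Real.exp (W ε)) 2 (fwdPathLaw ν₁ κR)) :
    1 / (∫ ε, (Real.exp (ΔF - W ε) / a + 1 / b)⁻¹ ∂(fwdPathLaw ν₁ κR)) - 1 / a - 1 / b ≤
      ((∫ ε, Real.exp (2 * W ε) ∂(fwdPathLaw ν₁ κR)) /
          (∫ ε, Real.exp (W ε) ∂(fwdPathLaw ν₁ κR)) ^ 2 - 1) / b := by
  have hΔF' : Real.exp (-(-ΔF)) = ((ν₁ univ)⁻¹ * ν₀ univ).toReal := exp_freeEnergyDiff h0 h1 hΔF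
  have hL2' : MemLp (fun ε => Real.exp (-(-W ε))) 2 (fwdPathLaw ν₁ κR) := by
    simpa only [neg_neg] using hL2
  have hs := h.symm.blocksBound_le_inv_essF h1 h0 hΔF' hb ha hL2'
  simp only [neg_neg, mul_neg] at hs
  rw [h.bennettG_symm h0 h1 hΔF ha hb]
  have hG : ∫ ε, (Real.exp (-ΔF - -W ε) / b + 1 / a)⁻¹ ∂(fwdPathLaw ν₀ κF) =
      ∫ ε, (Real.exp (-(ΔF - W ε)) / b + 1 / a)⁻¹ ∂(fwdPathLaw ν₀ κF) := by
    refine integral_congr_ae (Eventually.of_forall fun ε => ?_)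
    simp only
    rw [show -ΔF - -W ε = -(ΔF - W ε) by ring]
  rw [hG] at hs
  linarith

end CrooksPair

end Summit.Ventures.LatticeQCDFlow.Exactness.GeneralNCMC
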